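import Mathlib
import Literature.GroupTheory.CombinatorialGroupTheory.SignedHurwitzAction
import HarnessLib

/-!
# Signed transvections: Hurwitz orbits of decomposable tuples stay decomposable
(refutation of the mod-p orbit stub without Ω-connectedness)

Topic `Literature/GroupTheory/CombinatorialGroupTheory` (librarian move 2026-08-16 of the
gate-parked module `Literature/Uncategorized/StubModpOrbitWithoutOmegaConnected.lean` — accept-time
relocation of propositions written inline in a `Summits/` proposal, human ruling 2026-08-15 — to the
directory of its mathematics; declarations byte-identical, only the namespace, this directory's, is
new; the old names remain behind as deprecated aliases).

* `Literature.GroupTheory.CombinatorialGroupTheory.StubModpOrbitWithoutOmegaConnected` — the (false) proposition;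
* `Literature.GroupTheory.CombinatorialGroupTheory.not_stubModpOrbitWithoutOmegaConnected` — its refutation, PROVED in this file
  (§ "General facts on signed transvections for a pairing" and the genus-2 witness below; the
  Summits-side original is `Summit.SmoothPoincare4.SmoothPoincare4.Theorems.AcyclicBisectionExists.Negative.ModpOrbit.stub_modpOrbit_false_without_omegaConnected`).
-/

namespace Literature.GroupTheory.CombinatorialGroupTheory

open Literature.GroupTheory.CombinatorialGroupTheory.SignedHurwitz

/-- `stub_modpOrbit` of line `modp-braid-orbits` with the hypothesis
`OmegaConnected (stdSymp (ZMod p) g) (letters (l₁ ++ l₂))` deleted (everything else verbatim); it is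
REFUTED below (`stub_modpOrbit_false_without_omegaConnected`), recorded as a `Prop` only to name what
was dropped. [folklore] -/
def StubModpOrbitWithoutOmegaConnected : Prop :=
  ∀ (g : ℕ), ∃ p₀ : ℕ, ∀ (p : ℕ) [Fact p.Prime], p₀ < p →
    ∀ (l₁ l₂ : List ((Fin g ⊕ Fin g → ZMod p) × Bool)),
    l₁.length = 2 * g → l₂.length = 2 * g →
    ((l₁ ++ l₂).filter (·.2)).length = 2 * g →
    Submodule.span (ZMod p) (letters l₁) = ⊤ → Submodule.span (ZMod p) (letters l₂) = ⊤ →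
    wordProduct (stdSymp (ZMod p) g) (l₁ ++ l₂) = 1 →
    ∃ m : List ((Fin g ⊕ Fin g → ZMod p) × Bool),
      HurwitzOrbit (stdSymp (ZMod p) g) (l₁ ++ l₂) m ∧
      Submodule.span (ZMod p) (classesOfSign m true) = ⊤

/-! ## General facts on signed transvections for a pairing

Everything below is PROVED (no new named fact).  The general lemmas are stated for an arbitrary
bilinear pairing `B` on a module; the witness section then specialises to the standard symplectic
plane sum `𝔽_p² ⊥ 𝔽_p²` in genus `2` and concludes `not_stubModpOrbitWithoutOmegaConnected`, the
Literature-side copy of the kernel-checked refutation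
`Summit.SmoothPoincare4.SmoothPoincare4.Theorems.AcyclicBisectionExists.Negative.ModpOrbit.stub_modpOrbit_false_without_omegaConnected`
(which imports this file and therefore cannot be cited from here).  The argument: since
`T_{i•v} = T_v⁻¹` when `i² = -1`, the decomposable word
`(f₁,+)(e₁,+)(i f₂,−)(i e₂,−) ++ (i e₁,+)(i f₁,+)(e₂,−)(f₂,−)` has trivial monodromy, both halves
span, exactly `2g = 4` letters are positive, yet along its whole signed Hurwitz orbit every letter
stays in `V₁ ∪ V₂` (`V₁ = ⟨e₁,f₁⟩ ⊥ V₂ = ⟨e₂,f₂⟩`) and every positive letter stays in `V₁`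
(a move between a `V₁`-letter and a `V₂`-letter is a plain swap, signs travel with letters), so
the positive classes never span; primes `p ≡ 1 (mod 4)` exceed every threshold `p₀`
(`Nat.exists_prime_gt_modEq_one`). -/

namespace StubModpOrbitWithoutOmegaConnected

section General

variable {R : Type*} [CommRing R] {V : Type*} [AddCommGroup V] [Module R V]
  (B : V →ₗ[R] V →ₗ[R] R)

/-- Signed transvections along mutually `B`-orthogonal classes commute. [folklore] -/
theorem transvection_comm_of_orthogonal {v w : V} (hvw : B v w = 0) (hwv : B w v = 0)
    (s t : Bool) :
    transvection B (v, s) * transvection B (w, t) = transvection B (w, t) * transvection B (v, s) := by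
  apply LinearMap.ext
  intro y
  simp only [Module.End.mul_apply, transvection_apply, map_add, map_smul, hvw, hwv,
    mul_zero, zero_smul, add_zero]
  abel

/-- Left-commutation form of `transvection_comm_of_orthogonal`. [folklore] -/
theorem transvection_left_comm_of_orthogonal {v w : V} (hvw : B v w = 0) (hwv : B w v = 0)
    (s t : Bool) (W : Module.End R V) :
    transvection B (v, s) * (transvection B (w, t) * W) =
      transvection B (w, t) * (transvection B (v, s) * W) := by
  rw [← mul_assoc, transvection_comm_of_orthogonal B hvw hwv, mul_assoc]

/-- Signed transvections of opposite signs along a `B`-isotropic class are mutually inverse: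
`T_v^{ε} T_v^{-ε} = 1`. [folklore] -/
theorem transvection_mul_transvection_not {v : V} (hv : B v v = 0) (s : Bool) :
    transvection B (v, s) * transvection B (v, !s) = 1 := by
  apply LinearMap.ext
  intro y
  simp only [Module.End.mul_apply, transvection_apply, map_add, map_smul, hv,
    mul_zero, zero_smul, add_zero, Module.End.one_apply]
  cases s <;> simp [neg_smul]

/-- Cancelling form of `transvection_mul_transvection_not` inside a longer product. [folklore] -/
theorem transvection_mul_transvection_not_mul {v : V} (hv : B v v = 0) (s : Bool)
    (W : Module.End R V) :
    transvection B (v, s) * (transvection B (v, !s) * W) = W := by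
  rw [← mul_assoc, transvection_mul_transvection_not B hv, one_mul]

/-- Rescaling a class by a square root of `-1` flips the sign of its signed transvection:
`T_{i•v}^{ε} = T_v^{-ε}` when `i * i = -1`. [folklore] -/
theorem transvection_smul_of_mul_self_eq_neg_one {i : R} (hi : i * i = -1) (v : V) (s : Bool) :
    transvection B (i • v, s) = transvection B (v, !s) := by
  apply LinearMap.ext
  intro y
  simp only [transvection_apply, map_smul, smul_eq_mul, LinearMap.smul_apply, smul_smul]
  congr 1
  have : sgn s * (i * B v y) * i = sgn (!s) * B v y := by
    have h2 : sgn s * (i * B v y) * i = (i * i) * (sgn s * B v y) := by ring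
    rw [h2, hi]
    cases s <;> simp
  rw [this]

variable {B}

/-- The new letter `b + c • a` produced by a signed Hurwitz move (`c = ± B(a,b)`, so `c = 0` when
`B a b = 0`) from letters lying in `U₁ ∪ U₂`, `U₁ ⊥ U₂`, with `b ∈ U₁` if `b` is positive, again
lies in `U₁ ∪ U₂`, and in `U₁` if positive. [folklore] -/
theorem decomposable_newLetter {U₁ U₂ : Submodule R V}
    (h12 : ∀ u ∈ U₁, ∀ w ∈ U₂, B u w = 0) (h21 : ∀ w ∈ U₂, ∀ u ∈ U₁, B w u = 0)
    {a b : V} {sb : Bool} (c : R)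
    (ha : a ∈ U₁ ∨ a ∈ U₂) (hb : b ∈ U₁ ∨ b ∈ U₂) (hbpos : sb = true → b ∈ U₁)
    (hc : B a b = 0 → c = 0) :
    ((b + c • a) ∈ U₁ ∨ (b + c • a) ∈ U₂) ∧ (sb = true → (b + c • a) ∈ U₁) := by
  rcases ha with ha | ha <;> rcases hb with hb | hb
  · exact ⟨Or.inl (add_mem hb (U₁.smul_mem _ ha)), fun _ => add_mem hb (U₁.smul_mem _ ha)⟩
  · obtain rfl : c = 0 := hc (h12 a ha b hb)
    simp only [zero_smul, add_zero]
    exact ⟨Or.inr hb, hbpos⟩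
  · obtain rfl : c = 0 := hc (h21 a ha b hb)
    simp only [zero_smul, add_zero]
    exact ⟨Or.inl hb, hbpos⟩
  · refine ⟨Or.inr (add_mem hb (U₂.smul_mem _ ha)), fun hs => ?_⟩
    obtain rfl : c = 0 := hc (h21 a ha b (hbpos hs))
    simpa using hbpos hs

/-- One signed Hurwitz move preserves decomposability along an orthogonal pair `U₁ ⊥ U₂` of
submodules with all positive letters in `U₁` (a move between a `U₁`-letter and a `U₂`-letter is
a plain swap; signs travel with letters). [folklore] -/
theorem hurwitzStep_decomposable {U₁ U₂ : Submodule R V}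
    (h12 : ∀ u ∈ U₁, ∀ w ∈ U₂, B u w = 0) (h21 : ∀ w ∈ U₂, ∀ u ∈ U₁, B w u = 0)
    {l l' : List (V × Bool)} (h : HurwitzStep B l l')
    (hl : ∀ x ∈ l, (x.1 ∈ U₁ ∨ x.1 ∈ U₂) ∧ (x.2 = true → x.1 ∈ U₁)) :
    ∀ x ∈ l', (x.1 ∈ U₁ ∨ x.1 ∈ U₂) ∧ (x.2 = true → x.1 ∈ U₁) := by
  obtain ⟨pre, suf, a, b, rfl, hl'⟩ := h
  have ha := hl a (by simp)
  have hb := hl b (by simp)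
  intro x hx
  rcases hl' with rfl | rfl
  · simp only [List.mem_append, List.mem_cons] at hx
    rcases hx with hx | rfl | rfl | hx
    · exact hl x (by simp [hx])
    · exact decomposable_newLetter h12 h21 (sgn a.2 * B a.1 b.1) ha.1 hb.1 hb.2
        (fun h0 => by rw [h0, mul_zero])
    · exact ha
    · exact hl x (by simp [hx])
  · simp only [List.mem_append, List.mem_cons] at hx
    rcases hx with hx | rfl | rfl | hx
    · exact hl x (by simp [hx])
    · exact hb
    · have := decomposable_newLetter h12 h21 (-(sgn b.2 * B b.1 a.1)) hb.1 ha.1 ha.2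
        (fun h0 => by rw [h0, mul_zero, neg_zero])
      simpa [sub_eq_add_neg, neg_smul] using this
    · exact hl x (by simp [hx])

/-- **Decomposable signed words stay decomposable along the signed Hurwitz orbit.**  If
`U₁ ⊥ U₂` (for `B`, both ways), every letter of `l` lies in `U₁` or in `U₂` and every positive
letter lies in `U₁`, then the same holds for every word in the signed Hurwitz orbit of `l`.
[folklore] -/
theorem hurwitzOrbit_decomposable {U₁ U₂ : Submodule R V}
    (h12 : ∀ u ∈ U₁, ∀ w ∈ U₂, B u w = 0) (h21 : ∀ w ∈ U₂, ∀ u ∈ U₁, B w u = 0)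
    {l l' : List (V × Bool)} (h : HurwitzOrbit B l l')
    (hl : ∀ x ∈ l, (x.1 ∈ U₁ ∨ x.1 ∈ U₂) ∧ (x.2 = true → x.1 ∈ U₁)) :
    ∀ x ∈ l', (x.1 ∈ U₁ ∨ x.1 ∈ U₂) ∧ (x.2 = true → x.1 ∈ U₁) := by
  induction h with
  | refl => exact hl
  | tail _ hstep ih => exact hurwitzStep_decomposable h12 h21 hstep ih

/-- If all positive letters of `m` lie in a proper submodule `U₁`, the positive classes of `m` do
not span. [folklore] -/
theorem span_classesOfSign_true_ne_top {U₁ U₂ : Submodule R V} (hU : U₁ ≠ ⊤)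
    {m : List (V × Bool)} (hm : ∀ x ∈ m, (x.1 ∈ U₁ ∨ x.1 ∈ U₂) ∧ (x.2 = true → x.1 ∈ U₁)) :
    Submodule.span R (classesOfSign m true) ≠ ⊤ := by
  intro htop
  apply hU
  apply top_unique
  rw [← htop]
  exact Submodule.span_le.mpr fun v hv => (hm (v, true) hv).2 rfl

/-- Closed formula for the standard symplectic pairing:
`ω(x, y) = ∑ₖ (x_{e_k} y_{f_k} - x_{f_k} y_{e_k})`. [folklore] -/
theorem stdSymp_apply_eq_sum (g : ℕ) (x y : Fin g ⊕ Fin g → R) :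
    stdSymp R g x y = ∑ k, (x (Sum.inl k) * y (Sum.inr k) - x (Sum.inr k) * y (Sum.inl k)) := by
  rw [Finset.sum_sub_distrib, sub_eq_add_neg]
  simp [stdSymp, Matrix.toLinearMap₂'_apply', dotProduct, Matrix.mulVec,
    Fintype.sum_sum_type, Matrix.fromBlocks, Matrix.one_apply]

end General

/-! ## The decomposable witness over `𝔽_p`, `p ≡ 1 (mod 4)`, genus `2` -/

section Witness

variable {p : ℕ}

local notation "V" => (Fin 2 ⊕ Fin 2 → ZMod p)
local notation "ω" => stdSymp (ZMod p) 2
/-- First symplectic plane `V₁ = ⟨e₁, f₁⟩ = {x | x_{e₂} = 0 ∧ x_{f₂} = 0}` (a term, not a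
definition). -/
local notation "V₁" => (LinearMap.ker (LinearMap.proj (Sum.inl 1)) ⊓
  LinearMap.ker (LinearMap.proj (Sum.inr 1)) : Submodule (ZMod p) V)
/-- Second symplectic plane `V₂ = ⟨e₂, f₂⟩ = {x | x_{e₁} = 0 ∧ x_{f₁} = 0}`. -/
local notation "V₂" => (LinearMap.ker (LinearMap.proj (Sum.inl 0)) ⊓
  LinearMap.ker (LinearMap.proj (Sum.inr 0)) : Submodule (ZMod p) V)
local notation "e₁" => (Pi.single (Sum.inl 0) 1 : V)
local notation "f₁" => (Pi.single (Sum.inr 0) 1 : V)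
local notation "e₂" => (Pi.single (Sum.inl 1) 1 : V)
local notation "f₂" => (Pi.single (Sum.inr 1) 1 : V)

/-- Closed formula for the standard symplectic form in genus `2`. [folklore] -/
theorem stdSymp_two_apply (x y : V) :
    ω x y = x (Sum.inl 0) * y (Sum.inr 0) - x (Sum.inr 0) * y (Sum.inl 0) +
      (x (Sum.inl 1) * y (Sum.inr 1) - x (Sum.inr 1) * y (Sum.inl 1)) := by
  rw [stdSymp_apply_eq_sum 2 x y, Fin.sum_univ_two]

/-- The standard symplectic form in genus `2` is alternating. [folklore] -/
theorem stdSymp_two_self (x : V) : ω x x = 0 := by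
  rw [stdSymp_two_apply]; ring

/-- Membership in `V₁`. [folklore] -/
theorem mem_V₁ {x : V} : x ∈ V₁ ↔ x (Sum.inl 1) = 0 ∧ x (Sum.inr 1) = 0 := by
  simp

/-- Membership in `V₂`. [folklore] -/
theorem mem_V₂ {x : V} : x ∈ V₂ ↔ x (Sum.inl 0) = 0 ∧ x (Sum.inr 0) = 0 := by
  simp

/-- `V₁ ⊥ V₂`. [folklore] -/
theorem stdSymp_V₁_V₂ : ∀ x ∈ V₁, ∀ y ∈ V₂, ω x y = 0 := by
  intro x hx y hy
  rw [mem_V₁] at hx; rw [mem_V₂] at hy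
  rw [stdSymp_two_apply, hx.1, hx.2, hy.1, hy.2]; ring

/-- `V₂ ⊥ V₁`. [folklore] -/
theorem stdSymp_V₂_V₁ : ∀ y ∈ V₂, ∀ x ∈ V₁, ω y x = 0 := by
  intro y hy x hx
  rw [mem_V₂] at hy; rw [mem_V₁] at hx
  rw [stdSymp_two_apply, hx.1, hx.2, hy.1, hy.2]; ring

/-- `V₁` is a proper submodule (`e₂ ∉ V₁`). [folklore] -/
theorem V₁_ne_top [Fact p.Prime] : V₁ ≠ ⊤ := by
  intro h
  have hmem : e₂ ∈ V₁ := h ▸ Submodule.mem_top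
  rw [mem_V₁] at hmem
  simp at hmem

/-- `e₁ ∈ V₁`. [folklore] -/
theorem e₁_mem_V₁ : e₁ ∈ V₁ := by simp
/-- `f₁ ∈ V₁`. [folklore] -/
theorem f₁_mem_V₁ : f₁ ∈ V₁ := by simp
/-- `e₂ ∈ V₂`. [folklore] -/
theorem e₂_mem_V₂ : e₂ ∈ V₂ := by simp
/-- `f₂ ∈ V₂`. [folklore] -/
theorem f₂_mem_V₂ : f₂ ∈ V₂ := by simp

/-- A set whose span contains the four coordinate vectors spans `V`. [folklore] -/
theorem span_eq_top_of_single_mem {S : Set V}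
    (h1 : e₁ ∈ Submodule.span (ZMod p) S) (h2 : f₁ ∈ Submodule.span (ZMod p) S)
    (h3 : e₂ ∈ Submodule.span (ZMod p) S) (h4 : f₂ ∈ Submodule.span (ZMod p) S) :
    Submodule.span (ZMod p) S = ⊤ := by
  apply top_unique
  rw [← (Pi.basisFun (ZMod p) (Fin 2 ⊕ Fin 2)).span_eq, Submodule.span_le]
  rintro _ ⟨j, rfl⟩
  rw [Pi.basisFun_apply]
  rcases j with j | j <;> fin_cases j
  · exact h1
  · exact h3
  · exact h2
  · exact h4

variable (i : ZMod p)

/-- `i • v ∈ span S ⇒ v ∈ span S` for `i * i = -1`. [folklore] -/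
theorem mem_span_of_smul_mem_span (hi : i * i = -1) {S : Set V} {v : V}
    (h : i • v ∈ Submodule.span (ZMod p) S) : v ∈ Submodule.span (ZMod p) S := by
  have := Submodule.smul_mem _ (-i) h
  rwa [smul_smul, neg_mul, hi, neg_neg, one_smul] at this

/-- First half `(f₁,+)(e₁,+)(i f₂,−)(i e₂,−)` of the witness word (a term, not a definition). -/
local notation "L₁" => ([(f₁, true), (e₁, true), (i • f₂, false), (i • e₂, false)] : List (V × Bool))
/-- Second half `(i e₁,+)(i f₁,+)(e₂,−)(f₂,−)` of the witness word. -/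
local notation "L₂" => ([(i • e₁, true), (i • f₁, true), (e₂, false), (f₂, false)] : List (V × Bool))

/-- The witness word is decomposable along `V₁ ⊥ V₂` with all positive letters in `V₁`.
[folklore] -/
theorem decomposable_witness :
    ∀ x ∈ L₁ ++ L₂, (x.1 ∈ V₁ ∨ x.1 ∈ V₂) ∧ (x.2 = true → x.1 ∈ V₁) := by
  intro x hx
  simp only [List.cons_append, List.nil_append, List.mem_cons, List.not_mem_nil, or_false] at hx
  rcases hx with rfl | rfl | rfl | rfl | rfl | rfl | rfl | rfl
  · exact ⟨Or.inl f₁_mem_V₁, fun _ => f₁_mem_V₁⟩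
  · exact ⟨Or.inl e₁_mem_V₁, fun _ => e₁_mem_V₁⟩
  · exact ⟨Or.inr (Submodule.smul_mem _ _ f₂_mem_V₂), fun h => by simp at h⟩
  · exact ⟨Or.inr (Submodule.smul_mem _ _ e₂_mem_V₂), fun h => by simp at h⟩
  · exact ⟨Or.inl (Submodule.smul_mem _ _ e₁_mem_V₁), fun _ => Submodule.smul_mem _ _ e₁_mem_V₁⟩
  · exact ⟨Or.inl (Submodule.smul_mem _ _ f₁_mem_V₁), fun _ => Submodule.smul_mem _ _ f₁_mem_V₁⟩
  · exact ⟨Or.inr e₂_mem_V₂, fun h => by simp at h⟩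
  · exact ⟨Or.inr f₂_mem_V₂, fun h => by simp at h⟩

/-- The first half spans. [folklore] -/
theorem span_letters_witness₁ (hi : i * i = -1) : Submodule.span (ZMod p) (letters L₁) = ⊤ := by
  have mem : ∀ v s, (v, s) ∈ L₁ → v ∈ Submodule.span (ZMod p) (letters L₁) :=
    fun v s h => Submodule.subset_span ⟨s, h⟩
  refine span_eq_top_of_single_mem (mem _ true ?_) (mem _ true ?_)
    (mem_span_of_smul_mem_span i hi (mem _ false ?_))
    (mem_span_of_smul_mem_span i hi (mem _ false ?_)) <;> simp

/-- The second half spans. [folklore] -/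
theorem span_letters_witness₂ (hi : i * i = -1) : Submodule.span (ZMod p) (letters L₂) = ⊤ := by
  have mem : ∀ v s, (v, s) ∈ L₂ → v ∈ Submodule.span (ZMod p) (letters L₂) :=
    fun v s h => Submodule.subset_span ⟨s, h⟩
  refine span_eq_top_of_single_mem (mem_span_of_smul_mem_span i hi (mem _ true ?_))
    (mem_span_of_smul_mem_span i hi (mem _ true ?_)) (mem _ false ?_) (mem _ false ?_) <;> simp

/-- The witness word has exactly `2g = 4` positive letters and halves of length `2g`. [folklore] -/
theorem length_witness :
    (L₁).length = 2 * 2 ∧ (L₂).length = 2 * 2 ∧ ((L₁ ++ L₂).filter (·.2)).length = 2 * 2 := by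
  simp

/-- The monodromy of the witness word is trivial. [folklore] -/
theorem wordProduct_witness (hi : i * i = -1) : wordProduct ω (L₁ ++ L₂) = 1 := by
  have hself : ∀ x : V, ω x x = 0 := stdSymp_two_self
  -- rewrite the four `i`-letters as sign-flipped letters
  simp only [List.cons_append, List.nil_append, wordProduct_cons, wordProduct_nil,
    transvection_smul_of_mul_self_eq_neg_one ω hi, Bool.not_true, Bool.not_false]
  -- now: T f₁⁺ (T e₁⁺ (T f₂⁺ (T e₂⁺ (T e₁⁻ (T f₁⁻ (T e₂⁻ (T f₂⁻ 1)))))))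
  have c1 : ∀ (s t : Bool) (W : Module.End (ZMod p) V),
      transvection ω (e₂, s) * (transvection ω (e₁, t) * W) =
        transvection ω (e₁, t) * (transvection ω (e₂, s) * W) :=
    fun s t W => transvection_left_comm_of_orthogonal ω (stdSymp_V₂_V₁ _ e₂_mem_V₂ _ e₁_mem_V₁)
      (stdSymp_V₁_V₂ _ e₁_mem_V₁ _ e₂_mem_V₂) s t W
  have c2 : ∀ (s t : Bool) (W : Module.End (ZMod p) V),
      transvection ω (f₂, s) * (transvection ω (e₁, t) * W) =
        transvection ω (e₁, t) * (transvection ω (f₂, s) * W) :=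
    fun s t W => transvection_left_comm_of_orthogonal ω (stdSymp_V₂_V₁ _ f₂_mem_V₂ _ e₁_mem_V₁)
      (stdSymp_V₁_V₂ _ e₁_mem_V₁ _ f₂_mem_V₂) s t W
  have c3 : ∀ (s t : Bool) (W : Module.End (ZMod p) V),
      transvection ω (e₂, s) * (transvection ω (f₁, t) * W) =
        transvection ω (f₁, t) * (transvection ω (e₂, s) * W) :=
    fun s t W => transvection_left_comm_of_orthogonal ω (stdSymp_V₂_V₁ _ e₂_mem_V₂ _ f₁_mem_V₁)
      (stdSymp_V₁_V₂ _ f₁_mem_V₁ _ e₂_mem_V₂) s t W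
  have c4 : ∀ (s t : Bool) (W : Module.End (ZMod p) V),
      transvection ω (f₂, s) * (transvection ω (f₁, t) * W) =
        transvection ω (f₁, t) * (transvection ω (f₂, s) * W) :=
    fun s t W => transvection_left_comm_of_orthogonal ω (stdSymp_V₂_V₁ _ f₂_mem_V₂ _ f₁_mem_V₁)
      (stdSymp_V₁_V₂ _ f₁_mem_V₁ _ f₂_mem_V₂) s t W
  rw [c1, c2]            -- move e₁⁻ left past e₂⁺ then f₂⁺
  rw [show transvection ω (e₁, true) * (transvection ω (e₁, false) * _) = _ from
    transvection_mul_transvection_not_mul ω (hself e₁) true _]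
  rw [c3, c4]            -- move f₁⁻ left past e₂⁺ then f₂⁺
  rw [show transvection ω (f₁, true) * (transvection ω (f₁, false) * _) = _ from
    transvection_mul_transvection_not_mul ω (hself f₁) true _]
  -- remaining: T f₂⁺ (T e₂⁺ (T e₂⁻ (T f₂⁻ 1))) = 1
  rw [show transvection ω (e₂, true) * (transvection ω (e₂, false) * _) = _ from
    transvection_mul_transvection_not_mul ω (hself e₂) true _]
  rw [show transvection ω (f₂, true) * (transvection ω (f₂, false) * _) = _ from
    transvection_mul_transvection_not_mul ω (hself f₂) true _]

/-- The witness at a prime `p` admitting `i` with `i * i = -1`: every hypothesis of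
`StubModpOrbitWithoutOmegaConnected` at `g = 2` holds for `L₁, L₂`, but no word in the signed
Hurwitz orbit of `L₁ ++ L₂` has spanning positive classes. [folklore] -/
theorem witness_spec [Fact p.Prime] (hi : i * i = -1) :
    (L₁).length = 2 * 2 ∧ (L₂).length = 2 * 2 ∧ ((L₁ ++ L₂).filter (·.2)).length = 2 * 2 ∧
    Submodule.span (ZMod p) (letters L₁) = ⊤ ∧ Submodule.span (ZMod p) (letters L₂) = ⊤ ∧
    wordProduct ω (L₁ ++ L₂) = 1 ∧
    ∀ m, HurwitzOrbit ω (L₁ ++ L₂) m → Submodule.span (ZMod p) (classesOfSign m true) ≠ ⊤ := by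
  refine ⟨(length_witness i).1, (length_witness i).2.1, (length_witness i).2.2,
    span_letters_witness₁ i hi, span_letters_witness₂ i hi, wordProduct_witness i hi, fun m hm => ?_⟩
  exact span_classesOfSign_true_ne_top V₁_ne_top
    (hurwitzOrbit_decomposable stdSymp_V₁_V₂ stdSymp_V₂_V₁ hm (decomposable_witness i))

end Witness

end StubModpOrbitWithoutOmegaConnected

open StubModpOrbitWithoutOmegaConnected in
/-- **`StubModpOrbitWithoutOmegaConnected` is false** — the `OmegaConnected` hypothesis of stub
`stub_modpOrbit` (line `modp-braid-orbits`) is load-bearing.  At genus `2`, for every prime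
`p ≡ 1 (mod 4)` (these exceed any threshold `p₀`, `Nat.exists_prime_gt_modEq_one`), the
decomposable word `(f₁,+)(e₁,+)(i f₂,−)(i e₂,−) ++ (i e₁,+)(i f₁,+)(e₂,−)(f₂,−)` (`i² = −1`,
`ZMod.exists_sq_eq_neg_one_iff`) satisfies every other hypothesis while along its whole signed
Hurwitz orbit all positive letters stay in the plane `V₁ = ⟨e₁, f₁⟩` (`witness_spec`).  This is
the Literature-side statement of
`Summit.SmoothPoincare4.SmoothPoincare4.Theorems.AcyclicBisectionExists.Negative.ModpOrbit.stub_modpOrbit_false_without_omegaConnected`.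
[folklore] -/
theorem not_stubModpOrbitWithoutOmegaConnected : ¬ StubModpOrbitWithoutOmegaConnected := by
  intro h
  obtain ⟨p₀, hp₀⟩ := h 2
  obtain ⟨p, hp, hlt, hmod⟩ := Nat.exists_prime_gt_modEq_one p₀ (by norm_num : (4 : ℕ) ≠ 0)
  haveI : Fact p.Prime := ⟨hp⟩
  have hmod' : p % 4 = 1 := by
    have h4 : (1 : ℕ) % 4 = 1 := by norm_num
    rw [Nat.ModEq, h4] at hmod
    exact hmod
  obtain ⟨i, hi⟩ : IsSquare (-1 : ZMod p) := ZMod.exists_sq_eq_neg_one_iff.mpr (by omega)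
  have hi' : i * i = -1 := hi.symm
  obtain ⟨h1, h2, h3, h4, h5, h6, h7⟩ := witness_spec i hi'
  obtain ⟨m, hm, hspan⟩ := hp₀ p hlt _ _ h1 h2 h3 h4 h5 h6
  exact h7 m hm hspan

end Literature.GroupTheory.CombinatorialGroupTheory
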